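import Literature.AnabelianGeometry.SemiGraphs.AmbientVocabReal
import Literature.AnabelianGeometry.SemiGraphs.AmbientVocabDictionary
import Literature.AnabelianGeometry.SemiGraphs.AmbientVocabConnected
import Literature.AnabelianGeometry.SemiGraphs.LocalizationsProperties
import Literature.AnabelianGeometry.SemiGraphs.CoverticialRemark241Holds
import Literature.AnabelianGeometry.SemiGraphs.FiniteEtaleCoveringDictionaryProofs5
import Literature.AnabelianGeometry.Anabelioids.AutOfEquivalence
import Literature.AnabelianGeometry.AbsoluteAnabelian.GaloisSubextensionProofs

/-!
# [SemiAnbd] Prop 4.3 (i) at the real vocabulary: finite open objects, closed objects and arrows PROVED; the node modulo ONE heredity law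

Mochizuki, *Semi-graphs of anabelioids*, Publ. RIMS **42** (2006), §4 Prop 4.3 (i) p.52: "The underlying
semi-graph of anabelioids of an object of `Loc(𝔾, Γ)` is connected, coherent, totally elevated, totally
universally sub-coverticial, totally aloof, verticially slim, and of injective type; if, moreover, this
object is finite open, then it is of positive verticial length.  The underlying morphism of semi-graphs
of a morphism of `Loc(𝔾, Γ)` is locally finite étale"; proof p.53: "Assertion (i) … is immediate from
the definitions [cf. also Remark 2.4.1]" (kurims `paper:url-f33ace170ff4`).  Definitions consumed: the
objects of `Loc(𝔾, Γ)` pp.51–52 (finite open objects are "finite, connected, quasi-coherent, totally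
elevated, totally universally sub-coverticial" with a local `(𝔾, Γ)`-structure and "at least one
non-isolated open edge"; tempered objects are connected tempered coverings of `𝔾` with the induced
structure), Def 4.1 (iii)–(iv) pp.50–51 (structure morphisms are locally finite étale), Def 2.3 (iii)
p.25 (coherent = quasi-coherent with topologically finitely generated `π̂₁(𝒢_c)`; quasi-coherent
includes "of injective type"), Def 2.2 (ii) p.24 (locally open), Rmk 2.4.1 p.26.
[cite: MochizukiSemiAnbd2006, Prop 4.3 (i), p. 52]

PROOF-ONLY (abc-iut-L3-t3 lineage, gen 11; MERGE-MAP.md §4 item 5 «§4–§5 statements at the real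
vocabulary»; no definition, no instance, nothing restated; totally aloof / verticially slim are AMBIENT in
`SgA` and not conjuncts of the node).  At `𝓥 := SemiAnbdVocab.ofReal R` (`AmbientVocabOfReal.lean`) the
node `Loc.BasicPropertiesStatementI 𝓥 G Γ` (`LocalizationsProperties.lean`) has three legs:

1. ARROWS — locally finite étale by the definition of the arrows (p.52): `Loc.isLocallyFiniteEtale_hom_ofReal`
   (every `R`).
2. FINITE OPEN OBJECTS — `Loc.LocObj.basicPropertiesI_of_isFiniteOpen_ofReal` (every `R`): connected /
   totally elevated / totally universally sub-coverticial are the datum of p.51; injective type is part of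
   quasi-coherence (Def 2.3 (iii)); positive verticial length from the non-isolated edge (every edge of an
   object of `SgA` abuts to a vertex); and **COHERENT** — the one clause with content:
   `Loc.LocObj.isCoherent_of_isQuasiCoherent_ofReal` — EVERY object of `Loc(𝔾, Γ)` over a coherent `𝔾`
   has topologically finitely generated vertex and edge groups, because its local `(𝔾, Γ)`-structure
   supplies locally finite étale structure morphisms `H[c] → 𝔾` (Def 4.1 (iii)), whose constituent at the
   centre of `H[c]` (anabelioid `H_c`, by `rfl`) is a finite étale morphism `H_c → 𝔾_{c'}` of connected
   anabelioids: `π₁` of it is injective ([GeoAn] Rem. 1.2.2.1, tree `isPi1Mono_of_isFiniteEtale`) with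
   open image (ambient arrows are locally open), and topological finite generation descends along such a
   map (`Anabelioids.isTopologicallyFinitelyGenerated_of_pi1Map`: open subgroups of compact topologically
   finitely generated groups are topologically finitely generated, [AbsTopI] §0).
3. TEMPERED OBJECTS (closed / infinite open) — connected by definition; coherent ⟸ quasi-coherent by 2.;
   injective type ⟸ quasi-coherent; the remaining «quasi-coherent, totally elevated, totally universally
   sub-coverticial» is HEREDITY along the tempered structure morphism `q : H → 𝔾` — print's "[cf. also
   Remark 2.4.1]".  Along FINITE ÉTALE `q` this heredity is a theorem of the tree
   (`SgA.heredity_of_finiteEtale`: `remark_2_4_1_covering_holds` for elevated / universally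
   sub-coverticial, `isQuasiCoherent_of_covering` + `covering_isOfInjectiveType_holds` (D4)/(D5) for
   quasi-coherent); along INFINITE tempered coverings it is not (see below).

Results:
* `Loc.basicPropertiesStatementI_ofReal_of_heredity R G Γ h` — **Prop 4.3 (i) at `ofReal R` for every
  residual `R`**, conditional on the ONE displayed law `h`: tempered arrows `q : H → 𝔾` of `R` out of a
  connected `H` (under the p.51 hypotheses on `(𝔾, Γ)`) have `H` quasi-coherent, totally elevated, totally
  universally sub-coverticial (a hypothesis on the free residual, t7 pattern — not a new fact);
* `Loc.basicPropertiesStatementI_ofReal_trivial` — **UNCONDITIONAL at the degenerate residual**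
  `SgA.BridgeResidual.trivial` (tempered := finite étale; non-vacuity instance, labelled as such);
* ★ `Loc.basicPropertiesStatementI_real_of_heredity G Γ h` — **at the parameter-free `SemiAnbdVocab.real`**
  (tempered := `SgA.IsTemperedArrow` = finite étale ∨ `IsTemperedCoveringOf`): CLOSED objects, finite open
  objects and arrows unconditionally; the only displayed input is heredity of the three adjectives along
  arrows REALISED BY A TEMPERED OBJECT OF `B^cov(𝒢)` (`SgA.IsTemperedCoveringOf`, Def 3.5 (ii)).  What the
  tree holds towards it (t2 carrier `ProfiniteSemiGraph.CovObj`): `CovObj.isTotallyElevated_coveringGraph`,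
  `CovObj.isCoherent_coveringGraph` (strictly coherent base; `isStrictlyCoherent_of_finite_holds`),
  `isOfInjectiveType_coveringGraph`, iso-transport `isTotallyElevated_of_iso` / `isQuasiCoherent_of_iso`;
  what it does NOT hold: universally-sub-coverticial heredity along infinite tempered coverings and the
  t2 → t1 transport of the three adjectives for `H.toSgA` (R1-bridge debt) — recorded, not claimed.

Honest scope: `ofReal` results at general universes `SgA.{v₁, u₁, u}`; the `real` corollary at one universe
(`SgA.{u,u,u}`, as `SemiAnbdVocab.real`).  Nothing here takes a side on [IUTchIII] Cor. 3.12; typed ≠ proved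
for the other §§4–5 statements; conditional ≠ discharged.
-/

noncomputable section

namespace Literature.AnabelianGeometry

open CategoryTheory CategoryTheory.Limits CategoryTheory.PreGaloisCategory

/-! ### 1. Topological finite generation descends along a `π₁`-monomorphism with open image -/

namespace Anabelioids

open AbsoluteAnabelian

universe w v₁ v₂ u₁ u₂

variable {X : Type u₁} [Category.{v₁} X] {Y : Type u₂} [Category.{v₂} Y]

/-- **Topological finite generation descends along a `π₁`-monomorphism with open image.**  For a
functor `P : Y ⥤ X` (the pull-back functor of a morphism of anabelioids `X → Y`) and a basepoint `F`
of `X`: if `π₁(P) : Aut F → Aut (P ⋙ F)` is injective with open image and `Aut (P ⋙ F)` is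
topologically finitely generated, then so is `Aut F` — the image is an open subgroup of a compact
group (topologically finitely generated, [AbsTopI] §0), and `π₁(P)` is a continuous bijection of the
compact `Aut F` onto it. [cite: MochizukiGeoAn2004, Rem. 1.2.2.1 p.17] -/
theorem isTopologicallyFinitelyGenerated_of_pi1Map (P : Y ⥤ X) (F : X ⥤ FintypeCat.{w})
    (hinj : Function.Injective (pi1Map P F)) (hopen : IsOpen (Set.range (pi1Map P F)))
    (h : IsTopologicallyFinitelyGenerated (Aut (P ⋙ F))) :
    IsTopologicallyFinitelyGenerated (Aut F) := by
  let U : Subgroup (Aut (P ⋙ F)) := (pi1Map P F).range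
  have hUo : IsOpen (U : Set (Aut (P ⋙ F))) := by
    rw [MonoidHom.coe_range]; exact hopen
  have hU : IsTopologicallyFinitelyGenerated U := h.subgroup_isOpen U hUo
  let e₀ : Aut F ≃* U := MulEquiv.ofBijective (pi1Map P F).rangeRestrict
    ⟨(pi1Map P F).rangeRestrict_injective_iff.mpr hinj, (pi1Map P F).rangeRestrict_surjective⟩
  have he₀ : Continuous e₀ := (continuous_pi1Map' P F).subtype_mk _
  let eₜ : Aut F ≃ₜ U := Continuous.homeoOfEquivCompactToT2 (f := e₀.toEquiv) he₀
  let e : Aut F ≃ₜ* U :=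
    { e₀ with continuous_toFun := he₀, continuous_invFun := eₜ.symm.continuous }
  exact hU.of_continuousMulEquiv e.symm

end Anabelioids

namespace SemiGraphs

/-! ### 2. Structure morphisms make vertex and edge groups topologically finitely generated -/

namespace SgAQuot

universe v₁ u₁ u

/-- Every arrow of the Rmk 2.4.2 category is the class of a 1-morphism over its base.
[cite: MochizukiSemiAnbd2006, Rmk 2.4.2, p. 26] -/
theorem exists_eq_homMk {X Y : SgAQuot.{v₁, u₁, u}} (a : X ⟶ Y) :
    ∃ φ : SemiGraphOfAnabelioids.HomOver X.toSgA Y.toSgA a.base, a = homMk φ := by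
  obtain ⟨f, c⟩ := a
  induction c using Quotient.ind with
  | _ φ => exact ⟨φ, rfl⟩

namespace SgA

open SemiGraphOfAnabelioids Anabelioids AbsoluteAnabelian

variable {H G : SgA.{v₁, u₁, u}}

/-- **A locally finite étale arrow `H[v] → 𝔾` to a coherent `𝔾` makes `π̂₁(H_v)` topologically
finitely generated**: its vertex component at the centre of `H[v]` (constituent anabelioid `H_v`) is
a finite étale morphism of connected anabelioids `H_v → 𝔾_w`, so `π₁` of it is injective
([GeoAn] Rem. 1.2.2.1) with open image (arrows of the ambient category are locally open, Def 2.2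
(ii)), and `π̂₁(𝔾_w)` is topologically finitely generated (Def 2.3 (iii) "coherent").
[cite: MochizukiSemiAnbd2006, Def 2.3 (iii), p. 25] -/
theorem isTopologicallyFinitelyGenerated_V_of_atVertex_hom (v : H.toSgA.graph.Vertex)
    (s : H.atVertex v ⟶ G) (hs : locallyFiniteEtale s.hom.hom) (hG : G.toSgA.IsCoherent)
    (F : H.toSgA.V v ⥤ FintypeCat.{v₁}) [FiberFunctor F] :
    IsTopologicallyFinitelyGenerated (Aut F) := by
  have hlo : locallyOpen s.hom.hom := locallyOpen_hom s
  obtain ⟨φ, hφ⟩ := exists_eq_homMk s.hom.hom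
  rw [hφ] at hs hlo
  change φ.toHom.IsLocallyFiniteEtale at hs
  change φ.toHom.IsLocallyOpen at hlo
  -- the vertex component at the centre `c` of `H[v]`, whose constituent anabelioid is `H_v`
  let Q : G.toSgA.V (s.hom.hom.base.vertexMap (H.centerV v)) ⥤ H.toSgA.V v :=
    (φ.toHom.φV (H.centerV v)).pullback
  have hfe : IsFiniteEtale Q := hs.1 (H.centerV v)
  haveI : FiberFunctor (Q ⋙ F) := fiberFunctor_comp_of_exact Q F
  have hinj : Function.Injective (pi1Map Q F) := isPi1Mono_of_isFiniteEtale hfe F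
  -- (the constituent category of `H[v]` at its centre is `H_v` by `rfl`, but not reducibly so:
  -- the basepoint instance is handed over explicitly)
  have hloV := hlo.1 (H.centerV v)
  have hopen : IsOpen (Set.range (pi1Map Q F)) := @hloV F (by exact ‹FiberFunctor F›)
  exact isTopologicallyFinitelyGenerated_of_pi1Map Q F hinj hopen (hG.fg_V _ (Q ⋙ F))

/-- **A locally finite étale arrow `H[e] → 𝔾` to a coherent `𝔾` makes `π̂₁(H_e)` topologically
finitely generated** (edge component at the centre of `H[e]`, constituent anabelioid `H_e`).
[cite: MochizukiSemiAnbd2006, Def 2.3 (iii), p. 25] -/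
theorem isTopologicallyFinitelyGenerated_E_of_atEdge_hom (e : H.toSgA.graph.Edge)
    (s : H.atEdge e ⟶ G) (hs : locallyFiniteEtale s.hom.hom) (hG : G.toSgA.IsCoherent)
    (F : H.toSgA.E e ⥤ FintypeCat.{v₁}) [FiberFunctor F] :
    IsTopologicallyFinitelyGenerated (Aut F) := by
  have hlo : locallyOpen s.hom.hom := locallyOpen_hom s
  obtain ⟨φ, hφ⟩ := exists_eq_homMk s.hom.hom
  rw [hφ] at hs hlo
  change φ.toHom.IsLocallyFiniteEtale at hs
  change φ.toHom.IsLocallyOpen at hlo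
  let Q : G.toSgA.E (s.hom.hom.base.edgeMap (H.centerE e)) ⥤ H.toSgA.E e :=
    (φ.toHom.φE (H.centerE e) _ rfl).pullback
  have hfe : IsFiniteEtale Q := hs.2 (H.centerE e)
  haveI : FiberFunctor (Q ⋙ F) := fiberFunctor_comp_of_exact Q F
  have hinj : Function.Injective (pi1Map Q F) := isPi1Mono_of_isFiniteEtale hfe F
  have hloE := hlo.2 (H.centerE e)
  have hopen : IsOpen (Set.range (pi1Map Q F)) := @hloE F (by exact ‹FiberFunctor F›)
  exact isTopologicallyFinitelyGenerated_of_pi1Map Q F hinj hopen (hG.fg_E _ (Q ⋙ F))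

/-! ### 3. The heredity law along FINITE ÉTALE arrows is a theorem of the tree -/

/-- **Heredity of the p.51 adjectives along finite étale arrows of the ambient category**: if
`q : H → 𝔾` is (the class of) a finite étale covering in print's sense (Def 2.2 (i)) and `𝔾` is
connected, quasi-coherent, totally elevated and totally universally sub-coverticial, then `H` is
quasi-coherent, totally elevated and totally universally sub-coverticial — [SemiAnbd] Rmk 2.4.1 along
finite étale coverings (`remark_2_4_1_covering_holds`: elevated vertices and universally
sub-coverticial edges pull back; a closed edge of `H` lies over a closed edge of `𝔾` since coverings
are proper) and the quasi-coherence / injective-type dictionary (D4)/(D5) of the covering lineage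
(`isQuasiCoherent_of_covering`, `covering_isOfInjectiveType_holds`).
[cite: MochizukiSemiAnbd2006, Rem. 2.4.1 p.26] -/
theorem heredity_of_finiteEtale (q : H ⟶ G) (hq : finiteEtale q.hom.hom)
    (hconn : G.toSgA.IsConnected) (hqc : G.toSgA.IsQuasiCoherent) (hTE : G.toSgA.IsTotallyElevated)
    (hUS : G.toSgA.IsTotallyUniversallySubCoverticial) :
    H.toSgA.IsQuasiCoherent ∧ H.toSgA.IsTotallyElevated ∧
      H.toSgA.IsTotallyUniversallySubCoverticial := by
  obtain ⟨φ, -, hφ⟩ := hq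
  obtain ⟨A, hloc, -, -, -⟩ := id hφ
  have h241 := remark_2_4_1_covering_holds _ _ φ hφ
  refine ⟨isQuasiCoherent_of_covering φ A hconn hloc hqc
      (covering_isOfInjectiveType_holds _ _ φ A hconn hloc hqc.isOfInjectiveType),
    ⟨fun v' => h241.1 v' (hTE.isElevated _)⟩,
    ⟨fun e' he' => h241.2.1 e' (hUS.isUniversallySubCoverticial _ ?_)⟩⟩
  -- the image of a closed edge under a (proper) covering is closed
  change G.toSgA.graph.vertCard (φ.base.edgeMap e') = 2
  rw [hloc.1 e']
  exact he'

end SgA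

end SgAQuot

/-! ### 4. Objects of `Loc(𝔾, Γ)` at `SemiAnbdVocab.ofReal R` (every residual `R`) -/

namespace Loc

open SgAQuot SgAQuot.SgA SemiGraphOfAnabelioids Anabelioids AbsoluteAnabelian

universe v₁ u₁ u

variable (R : SgA.BridgeResidual.{v₁, u₁, u}) {G : SgA.{v₁, u₁, u}} {Γ : Subgroup (Aut G)}

namespace LocObj

/-- **Every object of `Loc(𝔾, Γ)` over a coherent `𝔾` has topologically finitely generated vertex
groups**: its local `(𝔾, Γ)`-structure at `v` consists of locally finite étale structure morphisms
`H[v] → 𝔾` (Def 4.1 (iii)–(iv)). [cite: MochizukiSemiAnbd2006, Def 4.1 (iv), p. 51] -/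
theorem isTopologicallyFinitelyGenerated_V_ofReal (X : LocObj (SemiAnbdVocab.ofReal R) G Γ)
    (hG : G.toSgA.IsCoherent) (v : X.U.toSgA.graph.Vertex) (F : X.U.toSgA.V v ⥤ FintypeCat.{v₁})
    [FiberFunctor F] : IsTopologicallyFinitelyGenerated (Aut F) := by
  obtain ⟨s, hs, -⟩ := (X.L.atV v).exists_orbit
  exact isTopologicallyFinitelyGenerated_V_of_atVertex_hom v s hs hG F

/-- **Every object of `Loc(𝔾, Γ)` over a coherent `𝔾` has topologically finitely generated edge
groups** (structure morphisms `H[e] → 𝔾`). [cite: MochizukiSemiAnbd2006, Def 4.1 (iv), p. 51] -/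
theorem isTopologicallyFinitelyGenerated_E_ofReal (X : LocObj (SemiAnbdVocab.ofReal R) G Γ)
    (hG : G.toSgA.IsCoherent) (e : X.U.toSgA.graph.Edge) (F : X.U.toSgA.E e ⥤ FintypeCat.{v₁})
    [FiberFunctor F] : IsTopologicallyFinitelyGenerated (Aut F) := by
  obtain ⟨s, hs, -⟩ := (X.L.atE e).exists_orbit
  exact isTopologicallyFinitelyGenerated_E_of_atEdge_hom e s hs hG F

/-- **An object of `Loc(𝔾, Γ)` over a coherent `𝔾` is coherent as soon as it is quasi-coherent**
(Def 2.3 (iii): coherent = quasi-coherent with topologically finitely generated constituent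
groups). [cite: MochizukiSemiAnbd2006, Def 2.3 (iii), p. 25] -/
theorem isCoherent_of_isQuasiCoherent_ofReal (X : LocObj (SemiAnbdVocab.ofReal R) G Γ)
    (hG : G.toSgA.IsCoherent) (hX : X.U.toSgA.IsQuasiCoherent) : X.U.toSgA.IsCoherent :=
  ⟨hX, fun v F _ => X.isTopologicallyFinitelyGenerated_V_ofReal R hG v F,
    fun e F _ => X.isTopologicallyFinitelyGenerated_E_ofReal R hG e F⟩

/-- **Finite open objects of `Loc(𝔾, Γ)` are coherent** (over a coherent `𝔾`, as on p.51): they are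
quasi-coherent by definition (p.51) and their constituent groups are topologically finitely generated
by the structure morphisms. [cite: MochizukiSemiAnbd2006, Prop 4.3 (i), p. 52] -/
theorem isCoherent_of_isFiniteOpen_ofReal (X : LocObj (SemiAnbdVocab.ofReal R) G Γ)
    (hX : X.IsFiniteOpen) (hG : G.toSgA.IsCoherent) : X.U.toSgA.IsCoherent :=
  X.isCoherent_of_isQuasiCoherent_ofReal R hG (X.finOpen_wf hX).isQuasiCoherent

/-- **A finite open object has positive verticial length**: it has a non-isolated edge (p.52), and in
the ambient category every edge abuts to a vertex. [cite: MochizukiSemiAnbd2006, Prop 4.3 (i), p. 52] -/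
theorem vertLength_pos_of_isFiniteOpen_ofReal (X : LocObj (SemiAnbdVocab.ofReal R) G Γ)
    (hX : X.IsFiniteOpen) : 0 < X.vertLength (SemiAnbdVocab.ofReal R) := by
  obtain ⟨e, -, -⟩ := (X.finOpen_wf hX).exists_edge
  obtain ⟨-, w, -, -⟩ := X.U.everyEdgeAbuts e
  exact (ENat.card_pos_iff_nonempty _).mpr ⟨w⟩

/-- **[SemiAnbd] Prop 4.3 (i) for FINITE OPEN objects, at `SemiAnbdVocab.ofReal R` for every
residual `R`**: the underlying semi-graph of anabelioids of a finite open object of `Loc(𝔾, Γ)`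
(`𝔾` coherent) is connected, coherent, totally elevated, totally universally sub-coverticial and of
injective type, and the object has positive verticial length — "immediate from the definitions"
(p.53): the datum of p.51, `isCoherent_of_isFiniteOpen_ofReal`, and injective type ⊂ quasi-coherent
(Def 2.3 (iii)). [cite: MochizukiSemiAnbd2006, Prop 4.3 (i), p. 52] -/
theorem basicPropertiesI_of_isFiniteOpen_ofReal (X : LocObj (SemiAnbdVocab.ofReal R) G Γ)
    (hX : X.IsFiniteOpen) (hG : (SemiAnbdVocab.ofReal R).IsCoherent G) :
    (SemiAnbdVocab.ofReal R).IsConnected X.U ∧ (SemiAnbdVocab.ofReal R).IsCoherent X.U ∧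
      (SemiAnbdVocab.ofReal R).IsTotallyElevated X.U ∧
        (SemiAnbdVocab.ofReal R).IsTotallyUnivSubcoverticial X.U ∧
          (SemiAnbdVocab.ofReal R).IsOfInjectiveType X.U ∧
            (X.IsFiniteOpen (SemiAnbdVocab.ofReal R) → 0 < X.vertLength (SemiAnbdVocab.ofReal R)) :=
  have D := X.finOpen_wf hX
  ⟨D.isConnected, X.isCoherent_of_isFiniteOpen_ofReal R hX hG, D.isTotallyElevated,
    D.isTotallyUnivSubcoverticial, IsQuasiCoherent.isOfInjectiveType D.isQuasiCoherent,
    fun _ => X.vertLength_pos_of_isFiniteOpen_ofReal R hX⟩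

end LocObj

/-- **[SemiAnbd] Prop 4.3 (i), arrow clause, at `SemiAnbdVocab.ofReal R` for every `R`**: the
underlying morphism of an arrow of `Loc(𝔾, Γ)` is locally finite étale (p.52: by definition of the
arrows). [cite: MochizukiSemiAnbd2006, Prop 4.3 (i), p. 52] -/
theorem isLocallyFiniteEtale_hom_ofReal {X Y : LocObj (SemiAnbdVocab.ofReal R) G Γ} (f : X ⟶ Y) :
    (SemiAnbdVocab.ofReal R).IsLocallyFiniteEtale f.hom :=
  f.cond.1

/-! ### 5. The node `BasicPropertiesStatementI`: modulo heredity for every `R`; unconditionally at the trivial residual; modulo heredity along INFINITE tempered coverings at `real` -/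

/-- **[SemiAnbd] Prop 4.3 (i) at the real vocabulary `SemiAnbdVocab.ofReal R`, MODULO THE ONE LAW
IT CONSUMES ABOUT THE RESIDUAL**: if the tempered arrows `q : H → 𝔾` of `R` out of a connected,
quasi-coherent-or-not `H` inherit from `𝔾` (under the p.51 hypotheses on `(𝔾, Γ)`) the three
adjectives «quasi-coherent, totally elevated, totally universally sub-coverticial» — print's
"immediate from the definitions [cf. also Remark 2.4.1]" for the TEMPERED objects (connected
tempered coverings of `𝔾`, Def 3.5 (ii)), an explicit hypothesis on the free residual and not a new
fact — then every object of `Loc(𝔾, Γ)` is connected, coherent, totally elevated, totally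
universally sub-coverticial and of injective type, finite open objects have positive verticial
length, and arrows are locally finite étale.  (Coherence of the tempered objects needs only their
QUASI-coherence: `isCoherent_of_isQuasiCoherent_ofReal`.)
[cite: MochizukiSemiAnbd2006, Prop 4.3 (i), p. 52] -/
theorem basicPropertiesStatementI_ofReal_of_heredity (G : SgA.{v₁, u₁, u}) (Γ : Subgroup (Aut G))
    (h : LocHypotheses (SemiAnbdVocab.ofReal R) G Γ → ∀ {H : SgA.{v₁, u₁, u}} (q : H ⟶ G),
      R.IsTempered q → (SemiAnbdVocab.ofReal R).IsConnected H →
        H.toSgA.IsQuasiCoherent ∧ H.toSgA.IsTotallyElevated ∧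
          H.toSgA.IsTotallyUniversallySubCoverticial) :
    BasicPropertiesStatementI (SemiAnbdVocab.ofReal R) G Γ := by
  intro hLoc
  refine ⟨fun X => ?_, fun X Y f => isLocallyFiniteEtale_hom_ofReal R f⟩
  have hG : G.toSgA.IsCoherent := hLoc.isCoherent
  rcases hX : X.str with _ | p
  · exact X.basicPropertiesI_of_isFiniteOpen_ofReal R hX hG
  · obtain ⟨hconn, hT, -, -⟩ := X.tempered_wf p hX
    obtain ⟨hq, hTE, hUS⟩ := h hLoc p hT hconn
    exact ⟨hconn, X.isCoherent_of_isQuasiCoherent_ofReal R hG hq, hTE, hUS, hq.isOfInjectiveType,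
      fun hfo => absurd (hX.symm.trans hfo) (by simp)⟩

/-- At the real vocabulary the container's "connected" is t1's connectedness of the underlying
semi-graph (abc-iut-L3-t3 gen 4 `ofReal_isConnected_iff`). [cite: MochizukiSemiAnbd2006, §2, p. 22] -/
theorem isConnected_toSgA_of_ofReal {H : SgA.{v₁, u₁, u}}
    (h : (SemiAnbdVocab.ofReal R).IsConnected H) : H.toSgA.IsConnected :=
  ⟨(SemiAnbdVocab.ofReal_isConnected_iff R H).mp h⟩

/-- **[SemiAnbd] Prop 4.3 (i) UNCONDITIONALLY at the degenerate residual** `SgA.BridgeResidual.trivial`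
(tempered := finite étale, `AmbientVocabDictionary.lean`): there every tempered object is closed and
the heredity law is `heredity_of_finiteEtale`.  A non-vacuity instance of
`basicPropertiesStatementI_ofReal_of_heredity`, labelled as such — NOT print's tempered class.
[cite: MochizukiSemiAnbd2006, Prop 4.3 (i), p. 52] -/
theorem basicPropertiesStatementI_ofReal_trivial (G : SgA.{v₁, u₁, u}) (Γ : Subgroup (Aut G)) :
    BasicPropertiesStatementI (SemiAnbdVocab.ofReal SgA.BridgeResidual.trivial.{v₁, u₁, u}) G Γ :=
  basicPropertiesStatementI_ofReal_of_heredity _ G Γ fun hLoc _ q hq _ =>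
    heredity_of_finiteEtale q hq (isConnected_toSgA_of_ofReal _ hLoc.isConnected)
      hLoc.isCoherent.isQuasiCoherent hLoc.isTotallyElevated hLoc.isTotallyUnivSubcoverticial

/-- **[SemiAnbd] Prop 4.3 (i) at the parameter-free real vocabulary `SemiAnbdVocab.real`, modulo
heredity along the tempered coverings realised in `B^cov(𝒢)`** (`SgA.IsTemperedCoveringOf`, Def 3.5
(ii) read through the t1 → t2 presentation bridge): the tempered arrows of `SemiAnbdVocab.real` are
`SgA.IsTemperedArrow q` = finite étale ∨ `IsTemperedCoveringOf q`; along the FINITE ÉTALE ones the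
three adjectives are inherited by `heredity_of_finiteEtale` (so CLOSED objects are covered
unconditionally), and the only remaining input is the displayed law `h` for arrows realised by a
tempered object of `B^cov(𝒢)` (print: Rmk 2.4.1 / the proof of Prop 3.6 for infinite tempered
coverings; at the cell's t2 carrier `CovObj.isTotallyElevated_coveringGraph` and
`CovObj.isCoherent_coveringGraph` exist, the universally-sub-coverticial clause and the transport to
`H.toSgA` do not — NOT discharged here). [cite: MochizukiSemiAnbd2006, Prop 4.3 (i), p. 52] -/
theorem basicPropertiesStatementI_real_of_heredity (G : SgA.{u, u, u}) (Γ : Subgroup (Aut G))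
    (h : LocHypotheses SemiAnbdVocab.real.{u} G Γ → ∀ {H : SgA.{u, u, u}} (q : H ⟶ G),
      SgA.IsTemperedCoveringOf q → SemiAnbdVocab.real.{u}.IsConnected H →
        H.toSgA.IsQuasiCoherent ∧ H.toSgA.IsTotallyElevated ∧
          H.toSgA.IsTotallyUniversallySubCoverticial) :
    Literature.AnabelianGeometry.SemiGraphs.Loc.BasicPropertiesStatementI
      SemiAnbdVocab.real.{u} G Γ :=
  basicPropertiesStatementI_ofReal_of_heredity SgA.BridgeResidual.real G Γ fun hLoc _ q hq hH =>
    hq.elim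
      (fun hfe => heredity_of_finiteEtale q hfe (isConnected_toSgA_of_ofReal _ hLoc.isConnected)
        hLoc.isCoherent.isQuasiCoherent hLoc.isTotallyElevated hLoc.isTotallyUnivSubcoverticial)
      (fun hcov => h hLoc q hcov hH)

end Loc

end SemiGraphs

end Literature.AnabelianGeometry

end
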